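import Literature.MathematicalPhysics.QuantumLattice.OrbitStateLocalCertificate
import HarnessLib

/-!
# Local certificates read in the orbit state of an ARBITRARY unit vector (variational class)

Topic `Literature/MathematicalPhysics/QuantumLattice`; companion of `OrbitStateLocalCertificate.lean`
(`re_orbitState_ge_of_local_certificate_ineq`: the certificate identity read in the orbit-averaged
vector state of an EIGENVECTOR of the Hamiltonian lying in a charge sector). This file proves the
variant for an arbitrary unit vector `v` — no eigenvector hypothesis, no particle-number sector — which
is the soundness statement for the "energy-window / variational" tier of the reduced-density-matrix
bootstrap: a translation-invariant relaxation whose only constraints are moment positivity, the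
symmetry identifications, linear sector constraints that DO hold on `v` (e.g. `S^z`), the filling rows
and the energy row `ω(h) ≤ u` (Wang et al. 2024 §III, "⟨ψ|E↑ − H|ψ⟩ ≥ 0 … can be added as additional
constraints"; Han 2020 §2 for the translation-invariant form). Such certificates contain NO
stationarity terms `[H, X]` and NO commutators with charges that fail to act as scalars on `v`; in
exchange they bound the objective over every low-energy vector, eigenvector or not — the class met by
the symmetry-breaking trial states of Horsch–von der Linden / Kaplan–Horsch–von der Linden
(Koma–Tasaki 1994 §2.2), which are superpositions of different particle-number sectors.

## The statement (`re_orbitState_ge_of_variational_certificate_ineq`)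

`T_g` unitaries commuting with `A` (the Hamiltonian) and with the "filling" operators `G_i`, adjoints
preserving a subspace `K ∋ v` on which the sector charges `Q_r`, `C_j` act as real scalars; a sub-family
`T'_{v'}` of the orbit group translating a local energy `E_loc` onto `A` and local densities `D_i` onto
`G_i`; an identity
`X − c·1 − Σ_i μ_i (D_i − ν_i·1) − κ (u·1 − E_loc) = Σ Λ_ab O_aᴴ O_b + (Σ_l (U_l Y_l U_lᴴ − Y_l)
  + Σ_r (Z_r (Q_r − q_r) + (Q_r − q_r) Z'_r) + Σ_j (C_j W_j − W_j C_j)) + (Σ_m d_m (V_mᴴ − V_m) + Σ_k a_k M_k)`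
with `Λ ⪰ 0`, real `d_m`, contractions `M_k`. Then for EVERY unit `v ∈ K`:
`c − Σ_k ‖a_k‖ + Σ_i μ_i (Re⟨v, G_i v⟩/#V' − ν_i) + κ (u − Re⟨v, A v⟩/#V') ≤ Re ω̄_v(X)`.
With `κ ≥ 0` and `Re⟨v, Av⟩/#V' ≤ u` the energy term drops (`…_of_energy_le`).

References: J. Wang et al., PRX 14 (2024) 031006, §III [WangEtAl2024]; X. Han, arXiv:2006.06002, §2
[Han2020Bootstrap]; T. Koma, H. Tasaki, J. Stat. Phys. 76 (1994) 745, §2.2 [KomaTasaki1994];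
O. Bratteli, D. W. Robinson, *Operator Algebras and Quantum Statistical Mechanics 2*, §6.2.4
[BratteliRobinsonII1997].
-/

noncomputable section

namespace Literature.MathematicalPhysics.QuantumLattice

open Matrix Finset Literature.MathematicalPhysics.QuantumManyBody.StateRelaxation
open scoped ComplexOrder BigOperators

variable {n : Type*} [Fintype n] [DecidableEq n]

section OrbitStateInvariant
variable {G : Type*} [Fintype G]

/-- **The orbit state of an orbit-INVARIANT operator is its plain expectation**: if `B` commutes with
every `T_g` (unitaries), then `ω̄_v(B) = ⟨v, B v⟩` — used for the Hamiltonian and for the total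
filling operators, which need not act as scalars on `v`. Bratteli–Robinson II §6.2.4 (mean of an
invariant observable). [cite: BratteliRobinsonII1997, §6.2.4] -/
theorem orbitState_eq_of_forall_commute [Nonempty G] {T : G → Matrix n n ℂ}
    (hTT : ∀ g, (T g)ᴴ * T g = 1) {B : Matrix n n ℂ} (hTB : ∀ g, T g * B = B * T g) (v : n → ℂ) :
    orbitState T v B = star v ⬝ᵥ (B *ᵥ v) := by
  rw [orbitState_apply]
  have hterm : ∀ g, vectorState ((T g)ᴴ *ᵥ v) B = star v ⬝ᵥ (B *ᵥ v) := by
    intro g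
    have hTT' : T g * (T g)ᴴ = 1 := mul_eq_one_comm.mp (hTT g)
    rw [vectorState_apply, star_mulVec, conjTranspose_conjTranspose, ← dotProduct_mulVec, mulVec_mulVec,
      mulVec_mulVec, hTB g, Matrix.mul_assoc, hTT', Matrix.mul_one]
  simp_rw [hterm]
  rw [Finset.sum_const, Finset.card_univ, nsmul_eq_mul,
    inv_mul_cancel_left₀ (Nat.cast_ne_zero.mpr Fintype.card_ne_zero)]

end OrbitStateInvariant

section Certificate
variable {G : Type*} [Fintype G] [Nonempty G]

/-- **Local-objective certificate WITH DENSITY AND ENERGY ROWS, read in the orbit state of an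
ARBITRARY unit vector.** As `re_orbitState_ge_of_local_certificate_ineq` but WITHOUT the eigenvector
hypothesis and WITHOUT stationarity terms `[A, X_k]`: `T_g` unitaries commuting with `A` and with the
filling operators `G_i`, adjoints preserving `K ∋ v`; `Q_r`, `C_j` Hermitian acting as real scalars on
`K`; a sub-family `T'_{v'}` of the orbit group with `Σ_{v'} T'_{v'} E_loc T'_{v'}ᴴ = A`,
`Σ_{v'} T'_{v'} D_i T'_{v'}ᴴ = G_i`; real `d_m`, contractions `M_k`, `Λ ⪰ 0`. The identity proves
`c − Σ_k ‖a_k‖ + Σ_i μ_i (Re⟨v, G_i v⟩/#V' − ν_i) + κ (u − Re⟨v, A v⟩/#V') ≤ Re ω̄_v(X)` for every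
unit `v ∈ K` (no sign condition on `κ` at the identity level). Wang et al. 2024 §III (energy rows),
Han 2020 §2 eq. (2)–(3) (symmetry and sector rows), KSDN 2024 §5.3 (rounding residual).
[cite: WangEtAl2024, §III] [cite: Han2020Bootstrap, §2 eq. (2)–(3)] -/
theorem re_orbitState_ge_of_variational_certificate_ineq (A : Matrix n n ℂ)
    (K : Submodule ℂ (n → ℂ)) {v : n → ℂ} (hvK : v ∈ K) (hv : star v ⬝ᵥ v = 1)
    (T : G → Matrix n n ℂ) (hTA : ∀ g, T g * A = A * T g) (hTT : ∀ g, (T g)ᴴ * T g = 1)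
    (hTK : ∀ g, ∀ w ∈ K, (T g)ᴴ *ᵥ w ∈ K)
    {V' : Type*} [Fintype V'] [Nonempty V'] (T' : V' → Matrix n n ℂ)
    (hT' : ∀ v', ∃ σ : G ≃ G, ∀ g, T g * T' v' = T (σ g))
    (X Eloc : Matrix n n ℂ) (hE : ∑ v', T' v' * Eloc * (T' v')ᴴ = A) (κ₀ u₀ : ℝ)
    {δ' : Type*} (dens : Finset δ') (μ ν : δ' → ℝ) (D Gm : δ' → Matrix n n ℂ)
    (hD : ∀ i ∈ dens, ∑ v', T' v' * D i * (T' v')ᴴ = Gm i)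
    (hGT : ∀ i ∈ dens, ∀ g, T g * Gm i = Gm i * T g)
    {m : Type*} [Fintype m] [DecidableEq m] {Λ : Matrix m m ℂ} (hΛ : Λ.PosSemidef)
    (O : m → Matrix n n ℂ)
    {ι : Type*} (t : Finset ι) (U Y : ι → Matrix n n ℂ)
    (hUT : ∀ l ∈ t, ∃ σ : G ≃ G, ∀ g, T g * U l = T (σ g))
    {ρ : Type*} (r : Finset ρ) (Q Z Z' : ρ → Matrix n n ℂ) (q : ρ → ℝ)
    (hQh : ∀ i ∈ r, (Q i).IsHermitian) (hQ : ∀ i ∈ r, ∀ w ∈ K, Q i *ᵥ w = ((q i : ℝ) : ℂ) • w)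
    {γ : Type*} (u : Finset γ) (C W : γ → Matrix n n ℂ) (qc : γ → ℝ)
    (hCh : ∀ j ∈ u, (C j).IsHermitian) (hC : ∀ j ∈ u, ∀ w ∈ K, C j *ᵥ w = ((qc j : ℝ) : ℂ) • w)
    {δ : Type*} (ah : Finset δ) (dc : δ → ℝ) (V : δ → Matrix n n ℂ)
    {κ'' : Type*} (w : Finset κ'') (a : κ'' → ℂ) (M : κ'' → Matrix n n ℂ)
    (hM : ∀ k ∈ w, (M k).IsContraction) {c : ℝ}
    (hcert : X - (c : ℂ) • (1 : Matrix n n ℂ) -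
        ∑ i ∈ dens, ((μ i : ℝ) : ℂ) • (D i - ((ν i : ℝ) : ℂ) • (1 : Matrix n n ℂ)) -
        ((κ₀ : ℝ) : ℂ) • (((u₀ : ℝ) : ℂ) • (1 : Matrix n n ℂ) - Eloc) =
      gramForm Λ O +
        (∑ l ∈ t, (U l * Y l * (U l)ᴴ - Y l) +
          ∑ i ∈ r, (Z i * (Q i - ((q i : ℝ) : ℂ) • 1) + (Q i - ((q i : ℝ) : ℂ) • 1) * Z' i) +
          ∑ j ∈ u, (C j * W j - W j * C j)) +
        (∑ m' ∈ ah, ((dc m' : ℝ) : ℂ) • ((V m')ᴴ - V m') + ∑ k ∈ w, a k • M k)) :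
    c - ∑ k ∈ w, ‖a k‖ +
        ∑ i ∈ dens, μ i * ((star v ⬝ᵥ (Gm i *ᵥ v)).re / (Fintype.card V' : ℝ) - ν i) +
        κ₀ * (u₀ - (star v ⬝ᵥ (A *ᵥ v)).re / (Fintype.card V' : ℝ)) ≤ (orbitState T v X).re := by
  have hunit : ∀ g, star ((T g)ᴴ *ᵥ v) ⬝ᵥ ((T g)ᴴ *ᵥ v) = 1 := fun g => by
    rw [star_mulVec, conjTranspose_conjTranspose, ← dotProduct_mulVec, mulVec_mulVec,
      mul_eq_one_comm.mp (hTT g), one_mulVec, hv]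
  have hwK : ∀ g, (T g)ᴴ *ᵥ v ∈ K := fun g => hTK g v hvK
  set ω := orbitState T v with hω
  have hpos : ∀ x : Matrix n n ℂ, 0 ≤ ω (star x * x) := fun x => orbitState_nonneg T v x
  have hone : ω 1 = 1 := orbitState_one hTT hv
  set X' := X - ∑ i ∈ dens, ((μ i : ℝ) : ℂ) • (D i - ((ν i : ℝ) : ℂ) • (1 : Matrix n n ℂ)) -
    ((κ₀ : ℝ) : ℂ) • (((u₀ : ℝ) : ℂ) • (1 : Matrix n n ℂ) - Eloc) with hX'
  -- the null terms
  have hnull : ω (∑ l ∈ t, (U l * Y l * (U l)ᴴ - Y l) +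
      ∑ i ∈ r, (Z i * (Q i - ((q i : ℝ) : ℂ) • 1) + (Q i - ((q i : ℝ) : ℂ) • 1) * Z' i) +
      ∑ j ∈ u, (C j * W j - W j * C j)) = 0 := by
    rw [map_add, map_add, map_sum, map_sum, map_sum]
    have h2 : ∀ l ∈ t, ω (U l * Y l * (U l)ᴴ - Y l) = 0 := fun l hl => by
      rw [map_sub, hω, orbitState_conj_of_closed T v (hUT l hl) (Y l), sub_self]
    have h3 : ∀ i ∈ r, ω (Z i * (Q i - ((q i : ℝ) : ℂ) • 1) + (Q i - ((q i : ℝ) : ℂ) • 1) * Z' i) = 0 :=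
      fun i hi => orbitState_sector (hQh i hi) (fun g => hQ i hi _ (hwK g)) _ _
    have h4 : ∀ j ∈ u, ω (C j * W j - W j * C j) = 0 := fun j hj =>
      orbitState_commutator (hCh j hj) (fun g => hC j hj _ (hwK g)) _
    rw [Finset.sum_eq_zero h2, Finset.sum_eq_zero h3, Finset.sum_eq_zero h4, add_zero, add_zero]
  -- the residual terms
  have hres : -(∑ k ∈ w, ‖a k‖) ≤
      (ω (∑ m' ∈ ah, ((dc m' : ℝ) : ℂ) • ((V m')ᴴ - V m') + ∑ k ∈ w, a k • M k)).re := by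
    have hah : (ω (∑ m' ∈ ah, ((dc m' : ℝ) : ℂ) • ((V m')ᴴ - V m'))).re = 0 := by
      rw [map_sum, Complex.re_sum]
      exact Finset.sum_eq_zero fun m' _ => orbitState_re_real_smul_conjTranspose_sub T v (dc m') (V m')
    have hr : -(∑ k ∈ w, ‖a k‖) ≤ (ω (∑ k ∈ w, a k • M k)).re :=
      neg_sum_norm_le_re_map_sum w ω a M fun k hk => neg_norm_le_re_mul_orbitState hunit (hM k hk) (a k)
    rw [map_add, Complex.add_re, hah, zero_add]
    exact hr
  have hcert' : X' - (c : ℂ) • (1 : Matrix n n ℂ) =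
      gramForm Λ O +
        (∑ l ∈ t, (U l * Y l * (U l)ᴴ - Y l) +
          ∑ i ∈ r, (Z i * (Q i - ((q i : ℝ) : ℂ) • 1) + (Q i - ((q i : ℝ) : ℂ) • 1) * Z' i) +
          ∑ j ∈ u, (C j * W j - W j * C j)) +
        (∑ m' ∈ ah, ((dc m' : ℝ) : ℂ) • ((V m')ᴴ - V m') + ∑ k ∈ w, a k • M k) := by
    rw [hX', sub_right_comm _ _ ((c : ℂ) • (1 : Matrix n n ℂ)),
      sub_right_comm _ _ ((c : ℂ) • (1 : Matrix n n ℂ))]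
    exact hcert
  have h := le_re_map_of_certificate_residual ω hpos hone hΛ O hnull hres hcert'
  -- evaluate the constraint operators in the orbit state
  have hV' : (Fintype.card V' : ℂ) ≠ 0 := Nat.cast_ne_zero.mpr Fintype.card_ne_zero
  have hωE : ω Eloc = (star v ⬝ᵥ (A *ᵥ v)) / (Fintype.card V' : ℂ) := by
    rw [eq_div_iff hV', mul_comm, hω, ← orbitState_sum_conj T v T' hT' Eloc, hE]
    exact orbitState_eq_of_forall_commute hTT hTA v
  have hωD : ∀ i ∈ dens, ω (D i) = (star v ⬝ᵥ (Gm i *ᵥ v)) / (Fintype.card V' : ℂ) := fun i hi => by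
    rw [eq_div_iff hV', mul_comm, hω, ← orbitState_sum_conj T v T' hT' (D i), hD i hi]
    exact orbitState_eq_of_forall_commute hTT (hGT i hi) v
  have hωX' : ω X' = ω X -
      ∑ i ∈ dens, ((μ i : ℝ) : ℂ) * ((star v ⬝ᵥ (Gm i *ᵥ v)) / (Fintype.card V' : ℂ) - ((ν i : ℝ) : ℂ)) -
      ((κ₀ : ℝ) : ℂ) * (((u₀ : ℝ) : ℂ) - (star v ⬝ᵥ (A *ᵥ v)) / (Fintype.card V' : ℂ)) := by
    rw [hX', map_sub, map_sub, map_sum, map_smul, map_sub, map_smul, hone, hωE, smul_eq_mul, smul_eq_mul,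
      mul_one]
    congr 2
    refine Finset.sum_congr rfl fun i hi => ?_
    rw [map_smul, map_sub, map_smul, hone, hωD i hi, smul_eq_mul, smul_eq_mul, mul_one]
  have hre : (ω X').re = (ω X).re -
      ∑ i ∈ dens, μ i * ((star v ⬝ᵥ (Gm i *ᵥ v)).re / (Fintype.card V' : ℝ) - ν i) -
      κ₀ * (u₀ - (star v ⬝ᵥ (A *ᵥ v)).re / (Fintype.card V' : ℝ)) := by
    rw [hωX', Complex.sub_re, Complex.sub_re, Complex.re_sum]
    have e1 : ∀ i ∈ dens, (((μ i : ℝ) : ℂ) * ((star v ⬝ᵥ (Gm i *ᵥ v)) / (Fintype.card V' : ℂ) -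
        ((ν i : ℝ) : ℂ))).re = μ i * ((star v ⬝ᵥ (Gm i *ᵥ v)).re / (Fintype.card V' : ℝ) - ν i) := by
      intro i _
      rw [Complex.re_ofReal_mul, Complex.sub_re, Complex.ofReal_re, Complex.div_natCast_re]
    have e2 : (((κ₀ : ℝ) : ℂ) * (((u₀ : ℝ) : ℂ) - (star v ⬝ᵥ (A *ᵥ v)) / (Fintype.card V' : ℂ))).re =
        κ₀ * (u₀ - (star v ⬝ᵥ (A *ᵥ v)).re / (Fintype.card V' : ℝ)) := by
      rw [Complex.re_ofReal_mul, Complex.sub_re, Complex.ofReal_re, Complex.div_natCast_re]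
    rw [Finset.sum_congr rfl e1, e2]
  rw [hre] at h
  linarith

/-- **With the energy hypothesis**: `κ ≥ 0` and `Re⟨v, A v⟩/#V' ≤ u` give
`c − Σ_k ‖a_k‖ + Σ_i μ_i (Re⟨v, G_i v⟩/#V' − ν_i) ≤ Re ω̄_v(X)` for every unit `v ∈ K` — the vector is
feasible for the energy row, Wang et al. 2024 §III. [cite: WangEtAl2024, §III] -/
theorem re_orbitState_ge_of_variational_certificate_ineq_of_energy_le (A : Matrix n n ℂ)
    (K : Submodule ℂ (n → ℂ)) {v : n → ℂ} (hvK : v ∈ K) (hv : star v ⬝ᵥ v = 1)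
    (T : G → Matrix n n ℂ) (hTA : ∀ g, T g * A = A * T g) (hTT : ∀ g, (T g)ᴴ * T g = 1)
    (hTK : ∀ g, ∀ w ∈ K, (T g)ᴴ *ᵥ w ∈ K)
    {V' : Type*} [Fintype V'] [Nonempty V'] (T' : V' → Matrix n n ℂ)
    (hT' : ∀ v', ∃ σ : G ≃ G, ∀ g, T g * T' v' = T (σ g))
    (X Eloc : Matrix n n ℂ) (hE : ∑ v', T' v' * Eloc * (T' v')ᴴ = A) {κ₀ u₀ : ℝ} (hκ : 0 ≤ κ₀)
    (hu : (star v ⬝ᵥ (A *ᵥ v)).re / (Fintype.card V' : ℝ) ≤ u₀)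
    {δ' : Type*} (dens : Finset δ') (μ ν : δ' → ℝ) (D Gm : δ' → Matrix n n ℂ)
    (hD : ∀ i ∈ dens, ∑ v', T' v' * D i * (T' v')ᴴ = Gm i)
    (hGT : ∀ i ∈ dens, ∀ g, T g * Gm i = Gm i * T g)
    {m : Type*} [Fintype m] [DecidableEq m] {Λ : Matrix m m ℂ} (hΛ : Λ.PosSemidef)
    (O : m → Matrix n n ℂ)
    {ι : Type*} (t : Finset ι) (U Y : ι → Matrix n n ℂ)
    (hUT : ∀ l ∈ t, ∃ σ : G ≃ G, ∀ g, T g * U l = T (σ g))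
    {ρ : Type*} (r : Finset ρ) (Q Z Z' : ρ → Matrix n n ℂ) (q : ρ → ℝ)
    (hQh : ∀ i ∈ r, (Q i).IsHermitian) (hQ : ∀ i ∈ r, ∀ w ∈ K, Q i *ᵥ w = ((q i : ℝ) : ℂ) • w)
    {γ : Type*} (u : Finset γ) (C W : γ → Matrix n n ℂ) (qc : γ → ℝ)
    (hCh : ∀ j ∈ u, (C j).IsHermitian) (hC : ∀ j ∈ u, ∀ w ∈ K, C j *ᵥ w = ((qc j : ℝ) : ℂ) • w)
    {δ : Type*} (ah : Finset δ) (dc : δ → ℝ) (V : δ → Matrix n n ℂ)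
    {κ'' : Type*} (w : Finset κ'') (a : κ'' → ℂ) (M : κ'' → Matrix n n ℂ)
    (hM : ∀ k ∈ w, (M k).IsContraction) {c : ℝ}
    (hcert : X - (c : ℂ) • (1 : Matrix n n ℂ) -
        ∑ i ∈ dens, ((μ i : ℝ) : ℂ) • (D i - ((ν i : ℝ) : ℂ) • (1 : Matrix n n ℂ)) -
        ((κ₀ : ℝ) : ℂ) • (((u₀ : ℝ) : ℂ) • (1 : Matrix n n ℂ) - Eloc) =
      gramForm Λ O +
        (∑ l ∈ t, (U l * Y l * (U l)ᴴ - Y l) +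
          ∑ i ∈ r, (Z i * (Q i - ((q i : ℝ) : ℂ) • 1) + (Q i - ((q i : ℝ) : ℂ) • 1) * Z' i) +
          ∑ j ∈ u, (C j * W j - W j * C j)) +
        (∑ m' ∈ ah, ((dc m' : ℝ) : ℂ) • ((V m')ᴴ - V m') + ∑ k ∈ w, a k • M k)) :
    c - ∑ k ∈ w, ‖a k‖ +
        ∑ i ∈ dens, μ i * ((star v ⬝ᵥ (Gm i *ᵥ v)).re / (Fintype.card V' : ℝ) - ν i) ≤
      (orbitState T v X).re := by
  have h := re_orbitState_ge_of_variational_certificate_ineq A K hvK hv T hTA hTT hTK T' hT' X Eloc hE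
    κ₀ u₀ dens μ ν D Gm hD hGT hΛ O t U Y hUT r Q Z Z' q hQh hQ u C W qc hCh hC ah dc V w a M hM hcert
  have hslack : 0 ≤ κ₀ * (u₀ - (star v ⬝ᵥ (A *ᵥ v)).re / (Fintype.card V' : ℝ)) :=
    mul_nonneg hκ (sub_nonneg.2 hu)
  linarith

/-- **No invariant subspace, no sector/Casimir rows** (`K = ⊤`, `r = u = ∅`): the form in which a
variational certificate is read in an ARBITRARY unit vector `v` (window certificates of low-energy,
number-indefinite trial vectors). Same conclusion:
`c − Σ‖aₖ‖ + Σᵢ μᵢ (Re⟨v, Gᵢ v⟩/#V' − νᵢ) + κ (u − Re⟨v, A v⟩/#V') ≤ Re ω̄_v(X)`.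
[cite: WangEtAl2024, §III] [cite: Han2020Bootstrap, §2 eq. (2)–(3)] -/
theorem re_orbitState_ge_of_variational_certificate_ineq_top (A : Matrix n n ℂ)
    {v : n → ℂ} (hv : star v ⬝ᵥ v = 1)
    (T : G → Matrix n n ℂ) (hTA : ∀ g, T g * A = A * T g) (hTT : ∀ g, (T g)ᴴ * T g = 1)
    {V' : Type*} [Fintype V'] [Nonempty V'] (T' : V' → Matrix n n ℂ)
    (hT' : ∀ v', ∃ σ : G ≃ G, ∀ g, T g * T' v' = T (σ g))
    (X Eloc : Matrix n n ℂ) (hE : ∑ v', T' v' * Eloc * (T' v')ᴴ = A) (κ₀ u₀ : ℝ)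
    {δ' : Type*} (dens : Finset δ') (μ ν : δ' → ℝ) (D Gm : δ' → Matrix n n ℂ)
    (hD : ∀ i ∈ dens, ∑ v', T' v' * D i * (T' v')ᴴ = Gm i)
    (hGT : ∀ i ∈ dens, ∀ g, T g * Gm i = Gm i * T g)
    {m : Type*} [Fintype m] [DecidableEq m] {Λ : Matrix m m ℂ} (hΛ : Λ.PosSemidef)
    (O : m → Matrix n n ℂ)
    {ι : Type*} (t : Finset ι) (U Y : ι → Matrix n n ℂ)
    (hUT : ∀ l ∈ t, ∃ σ : G ≃ G, ∀ g, T g * U l = T (σ g))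
    {δ : Type*} (ah : Finset δ) (dc : δ → ℝ) (V : δ → Matrix n n ℂ)
    {κ'' : Type*} (w : Finset κ'') (a : κ'' → ℂ) (M : κ'' → Matrix n n ℂ)
    (hM : ∀ k ∈ w, (M k).IsContraction) {c : ℝ}
    (hcert : X - (c : ℂ) • (1 : Matrix n n ℂ) -
        ∑ i ∈ dens, ((μ i : ℝ) : ℂ) • (D i - ((ν i : ℝ) : ℂ) • (1 : Matrix n n ℂ)) -
        ((κ₀ : ℝ) : ℂ) • (((u₀ : ℝ) : ℂ) • (1 : Matrix n n ℂ) - Eloc) =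
      gramForm Λ O + ∑ l ∈ t, (U l * Y l * (U l)ᴴ - Y l) +
        (∑ m' ∈ ah, ((dc m' : ℝ) : ℂ) • ((V m')ᴴ - V m') + ∑ k ∈ w, a k • M k)) :
    c - ∑ k ∈ w, ‖a k‖ +
        ∑ i ∈ dens, μ i * ((star v ⬝ᵥ (Gm i *ᵥ v)).re / (Fintype.card V' : ℝ) - ν i) +
        κ₀ * (u₀ - (star v ⬝ᵥ (A *ᵥ v)).re / (Fintype.card V' : ℝ)) ≤ (orbitState T v X).re := by
  have hcert' : X - (c : ℂ) • (1 : Matrix n n ℂ) -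
        ∑ i ∈ dens, ((μ i : ℝ) : ℂ) • (D i - ((ν i : ℝ) : ℂ) • (1 : Matrix n n ℂ)) -
        ((κ₀ : ℝ) : ℂ) • (((u₀ : ℝ) : ℂ) • (1 : Matrix n n ℂ) - Eloc) =
      gramForm Λ O +
        (∑ l ∈ t, (U l * Y l * (U l)ᴴ - Y l) +
          ∑ i ∈ (∅ : Finset (Fin 0)), ((0 : Matrix n n ℂ) * ((0 : Matrix n n ℂ) - (((0 : ℝ) : ℝ) : ℂ) • 1) +
            ((0 : Matrix n n ℂ) - (((0 : ℝ) : ℝ) : ℂ) • 1) * (0 : Matrix n n ℂ)) +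
          ∑ j ∈ (∅ : Finset (Fin 0)), ((0 : Matrix n n ℂ) * (0 : Matrix n n ℂ) - (0 : Matrix n n ℂ) * (0 : Matrix n n ℂ))) +
        (∑ m' ∈ ah, ((dc m' : ℝ) : ℂ) • ((V m')ᴴ - V m') + ∑ k ∈ w, a k • M k) := by
    rw [Finset.sum_empty, Finset.sum_empty, add_zero, add_zero]; exact hcert
  exact re_orbitState_ge_of_variational_certificate_ineq A ⊤ Submodule.mem_top hv T hTA hTT
    (fun _ _ _ => Submodule.mem_top) T' hT' X Eloc hE κ₀ u₀ dens μ ν D Gm hD hGT hΛ O t U Y hUT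
    (∅ : Finset (Fin 0)) (fun _ => 0) (fun _ => 0) (fun _ => 0) (fun _ => 0)
    (fun i hi => absurd hi (Finset.notMem_empty i)) (fun i hi => absurd hi (Finset.notMem_empty i))
    (∅ : Finset (Fin 0)) (fun _ => 0) (fun _ => 0) (fun _ => 0)
    (fun j hj => absurd hj (Finset.notMem_empty j)) (fun j hj => absurd hj (Finset.notMem_empty j))
    ah dc V w a M hM hcert'

end Certificate

end Literature.MathematicalPhysics.QuantumLattice

end
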